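import Mathlib
import Literature.NumberTheory.Automorphic.HilbertModularFormQExpansion

/-!
# Crux `HilbertIntegralOverconvergentIsCongruence` (stmt-Langlands-8485), line `Sketch-ideate-r1-k1`,
# section M (Koecher principle at every cusp): stub `stub_slash_mul` (M-A1)

Section M of the line proves the Koecher principle for Hilbert modular forms (Freitag, *Hilbert Modular
Forms*, I.4.9 Cor.) by transporting the weight-`k` law of `f` along conjugates `γ g = g t` to the slashed
function `h = f|_k g`; this needs the elementary calculus of the action of `SL₂(F)` on `ℍ^{Hom(F,ℝ)}`
through the real embeddings (Freitag I §3–§4), which is this stub: the Möbius action preserves `ℍ`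
(`Im (g z)_σ = Im z_σ / |σ(c) z_σ + σ(d)|²`, using `det g = 1`), it is multiplicative
`(g₁ g₂) z = g₁ (g₂ z)` on `ℍ`, the automorphy factor `J_k(g, z) = ∏_σ (σ(c) z_σ + σ(d))^{k_σ}` is a
cocycle `J(g₁ g₂, z) = J(g₁, g₂ z) J(g₂, z)` on `ℍ`, and hence `f|_k (g₁ g₂) = (f|_k g₁)|_k g₂` on `ℍ`.
The proof is the `2 × 2` linear-fractional algebra: coordinatewise
`denom (g₁ g₂) z σ = denom g₁ (g₂ z) σ · denom g₂ z σ` and likewise for the numerators (entries of a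
product in `SL(2, F)`, casts of the real embeddings, `field_simp`, `ring`), then `mul_zpow` and
`Finset.prod_mul_distrib` for the cocycle, and `mul_inv` for the slash.
-/

set_option linter.dupNamespace false

noncomputable section

namespace Summit.Langlands.Langlands.Theorems.HilbertIntegralOverconvergentIsCongruence

open MeasureTheory Complex NumberField
open Literature.NumberTheory.Automorphic Literature.NumberTheory.Automorphic.HilbertModular
open scoped MatrixGroups

variable {F : Type} [Field F] [NumberField F]

omit [NumberField F] in
/-- Entries of a product in `SL(2, F)`: `(g₁ g₂)_{ij} = (g₁)_{i0} (g₂)_{0j} + (g₁)_{i1} (g₂)_{1j}`. -/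
theorem slm_mul_apply (g₁ g₂ : SL(2, F)) (i j : Fin 2) :
    (g₁ * g₂) i j = g₁ i 0 * g₂ 0 j + g₁ i 1 * g₂ 1 j := by
  simp [Matrix.SpecialLinearGroup.coe_mul, Matrix.mul_apply, Fin.sum_univ_two]

omit [NumberField F] in
/-- The determinant relation `σ(a) σ(d) - σ(b) σ(c) = 1` of `g = (a b; c d) ∈ SL₂(F)` through a real
embedding `σ`. -/
theorem slm_det_embedding (g : SL(2, F)) (σ : F →+* ℝ) :
    σ (g 0 0) * σ (g 1 1) - σ (g 0 1) * σ (g 1 0) = 1 := by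
  have h := Matrix.det_fin_two (g : Matrix (Fin 2) (Fin 2) F)
  rw [g.det_coe] at h
  rw [← map_mul, ← map_mul, ← map_sub, ← h, map_one]

omit [NumberField F] in
/-- The Möbius action at an embedding, unfolded: `(g z)_σ = (σ(a) z_σ + σ(b)) / (σ(c) z_σ + σ(d))`. -/
theorem slm_moeb_apply (g : SL(2, F)) (z : Point F) (σ : F →+* ℝ) :
    moeb g z σ = ((σ (g 0 0) : ℂ) * z σ + (σ (g 0 1) : ℂ)) / denom g z σ :=
  rfl

omit [NumberField F] in
/-- The imaginary part of the Möbius action: `Im (g z)_σ = Im z_σ / |σ(c) z_σ + σ(d)|²`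
(using `σ(a) σ(d) - σ(b) σ(c) = 1`; both sides are the junk value `0` where the denominator vanishes). -/
theorem slm_moeb_im (g : SL(2, F)) (z : Point F) (σ : F →+* ℝ) :
    (moeb g z σ).im = (z σ).im / Complex.normSq (denom g z σ) := by
  have hdet := slm_det_embedding g σ
  rw [slm_moeb_apply, Complex.div_im, ← sub_div]
  congr 1
  simp only [denom, add_re, mul_re, ofReal_re, ofReal_im, add_im, mul_im, zero_mul, sub_zero,
    add_zero]
  linear_combination (z σ).im * hdet

omit [NumberField F] in
/-- The Möbius action of `SL₂(F)` preserves the half space `ℍ^{Hom(F,ℝ)}`. -/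
theorem slm_moeb_mem_halfSpace (g : SL(2, F)) {z : Point F} (hz : z ∈ halfSpace F) :
    moeb g z ∈ halfSpace F := fun σ ↦ by
  rw [slm_moeb_im g z σ]
  exact div_pos (hz σ) (Complex.normSq_pos.2 (denom_ne_zero g hz σ))

omit [NumberField F] in
/-- The denominators compose: `denom (g₁ g₂) z σ = denom g₁ (g₂ z) σ · denom g₂ z σ` on `ℍ`. -/
theorem slm_denom_mul (g₁ g₂ : SL(2, F)) {z : Point F} (hz : z ∈ halfSpace F) (σ : F →+* ℝ) :
    denom (g₁ * g₂) z σ = denom g₁ (moeb g₂ z) σ * denom g₂ z σ := by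
  have hN : (σ (g₂ 1 0) : ℂ) * z σ + (σ (g₂ 1 1) : ℂ) ≠ 0 := denom_ne_zero g₂ hz σ
  simp only [denom, moeb, slm_mul_apply, map_add, map_mul, ofReal_add, ofReal_mul]
  field_simp
  ring

omit [NumberField F] in
/-- The numerators compose: `num (g₁ g₂) z σ = num g₁ (g₂ z) σ · denom g₂ z σ` on `ℍ`. -/
theorem slm_num_mul (g₁ g₂ : SL(2, F)) {z : Point F} (hz : z ∈ halfSpace F) (σ : F →+* ℝ) :
    (σ ((g₁ * g₂) 0 0) : ℂ) * z σ + (σ ((g₁ * g₂) 0 1) : ℂ) =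
      ((σ (g₁ 0 0) : ℂ) * moeb g₂ z σ + (σ (g₁ 0 1) : ℂ)) * denom g₂ z σ := by
  have hN : (σ (g₂ 1 0) : ℂ) * z σ + (σ (g₂ 1 1) : ℂ) ≠ 0 := denom_ne_zero g₂ hz σ
  simp only [denom, moeb, slm_mul_apply, map_add, map_mul, ofReal_add, ofReal_mul]
  field_simp
  ring

omit [NumberField F] in
/-- The Möbius action is multiplicative on `ℍ`: `(g₁ g₂) z = g₁ (g₂ z)`. -/
theorem slm_moeb_mul (g₁ g₂ : SL(2, F)) {z : Point F} (hz : z ∈ halfSpace F) :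
    moeb (g₁ * g₂) z = moeb g₁ (moeb g₂ z) := by
  funext σ
  rw [slm_moeb_apply (g₁ * g₂) z σ, slm_moeb_apply g₁ (moeb g₂ z) σ, slm_denom_mul g₁ g₂ hz σ,
    slm_num_mul g₁ g₂ hz σ, mul_div_mul_right _ _ (denom_ne_zero g₂ hz σ)]

/-- The automorphy factor is a cocycle on `ℍ`: `J_k(g₁ g₂, z) = J_k(g₁, g₂ z) J_k(g₂, z)`. -/
theorem slm_autFactor_mul (k : (F →+* ℝ) → ℤ) (g₁ g₂ : SL(2, F)) {z : Point F}
    (hz : z ∈ halfSpace F) :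
    autFactor k (g₁ * g₂) z = autFactor k g₁ (moeb g₂ z) * autFactor k g₂ z := by
  rw [autFactor, autFactor, autFactor, ← Finset.prod_mul_distrib]
  exact Finset.prod_congr rfl fun σ _ ↦ by rw [slm_denom_mul g₁ g₂ hz σ, mul_zpow]

/-- The weight-`k` slash is a right action on `ℍ`: `(f|_k (g₁ g₂))(z) = ((f|_k g₁)|_k g₂)(z)`. -/
theorem slm_slash_mul (k : (F →+* ℝ) → ℤ) (g₁ g₂ : SL(2, F)) (f : Point F → ℂ) {z : Point F}
    (hz : z ∈ halfSpace F) :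
    slash k (g₁ * g₂) f z = slash k g₂ (slash k g₁ f) z := by
  simp only [slash]
  rw [slm_autFactor_mul k g₁ g₂ hz, slm_moeb_mul g₁ g₂ hz, mul_inv]
  ring

/-- **stub M-A1 — `stub_slash_mul`.** The Möbius action of `SL₂(F)` on `ℍ^{Hom(F,ℝ)}` through the real
embeddings is an action preserving `ℍ`, the automorphy factor is a cocycle, and consequently the weight-`k` slash
is a right action: `f|(g₁g₂) = (f|g₁)|g₂` on `ℍ` (Freitag I.4 (4.3)–(4.4); `Im (gz)_σ = Im z_σ / |σ(c) z_σ + σ(d)|²`).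
[cite: Freitag1990, Ch. I §4] -/
theorem stub_slash_mul (F : Type) [Field F] [NumberField F] (k : (F →+* ℝ) → ℤ) (g₁ g₂ : SL(2, F))
    (f : Point F → ℂ) (z : Point F) (hz : z ∈ halfSpace F) :
    moeb g₂ z ∈ halfSpace F ∧ moeb (g₁ * g₂) z = moeb g₁ (moeb g₂ z) ∧
      autFactor k (g₁ * g₂) z = autFactor k g₁ (moeb g₂ z) * autFactor k g₂ z ∧
      slash k (g₁ * g₂) f z = slash k g₂ (slash k g₁ f) z :=
  ⟨slm_moeb_mem_halfSpace g₂ hz, slm_moeb_mul g₁ g₂ hz, slm_autFactor_mul k g₁ g₂ hz,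
    slm_slash_mul k g₁ g₂ f hz⟩

end Summit.Langlands.Langlands.Theorems.HilbertIntegralOverconvergentIsCongruence
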